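import Summits.Ventures.Crystal3D.Theorems.StickyWulffConstantPolycrystalWulffBoundMinkowskiFacetSlab

/-!
# `PolycrystalWulffBound`, rung `rung_basalLamellar` — step 2b: two transversal thin slabs meet a
# ball in volume `O(w·w')` (line `PolyDensity`, crux `stmt-Ventures-19482`)

Route `StickyWulffConstant` of the venture `Summits/Ventures/Crystal3D`, second prover lane (poly-p2,
gen 3).  Second piece of plumbing for the polyhedral anisotropic MINKOWSKI-CONTENT bound: the
contribution of NON-adjacent cell pairs to the chimera neighbourhood lies in the intersection of two
thin slabs about distinct planes; for transversal planes this is `O(r²)`: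
* `volume_strip_inter_square_le` — a planar strip `{|c₁y₁ + c₂y₂ + d| < w}` with `(c₁, c₂) ≠ 0`
  meets the square `[-R, R]²` in area `≤ 4·R·w / max(|c₁|, |c₂|)`... stated with `|c₂| ≥ |c₁|`
  resp. the symmetric case folded in;
* `volume_two_slabs_inter_ball_le` — for unit `a, a'` with `a' ≠ ±a` there is `C` with
  `|{α−w < ⟪a,x⟫ < α+w} ∩ {α'−w' < ⟪a',x⟫ < α'+w'} ∩ B̄(0,R₀)| ≤ C·w·w'` for all `w, w' ≥ 0`.
WHAT THIS IS NOT: anything about textures or the crux.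
-/

noncomputable section

open scoped BigOperators InnerProductSpace ENNReal Pointwise
open MeasureTheory Set

namespace Summit.Ventures.Crystal3D.Theorems

/-- A planar strip `{y | |c₁ y₁ + c₂ y₂ + d| < w}` with `c₂ ≠ 0` meets `[-R, R] × ℝ` in area
`≤ 2R · (2w/|c₂|)`. -/
theorem volume_strip_inter_le {c₁ c₂ d w R : ℝ} (hc₂ : c₂ ≠ 0) (hw : 0 ≤ w) :
    volume ({y : ℝ × ℝ | |c₁ * y.1 + c₂ * y.2 + d| < w} ∩ {y | y.1 ∈ Set.Icc (-R) R}) ≤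
      ENNReal.ofReal (2 * R * (2 * w / |c₂|)) := by
  set S : Set (ℝ × ℝ) := {y : ℝ × ℝ | |c₁ * y.1 + c₂ * y.2 + d| < w} ∩ {y | y.1 ∈ Set.Icc (-R) R} with hS
  have hSm : MeasurableSet S := by
    refine MeasurableSet.inter ?_ (measurableSet_Icc.preimage measurable_fst)
    exact measurableSet_lt ((by fun_prop : Measurable fun y : ℝ × ℝ => |c₁ * y.1 + c₂ * y.2 + d|))
      measurable_const
  rw [Measure.volume_eq_prod, Measure.prod_apply hSm]
  -- sections in `y₂` are intervals of length `2w/|c₂|`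
  have hsec : ∀ y₁ : ℝ, volume (Prod.mk y₁ ⁻¹' S) ≤
      (Set.Icc (-R) R).indicator (fun _ => ENNReal.ofReal (2 * w / |c₂|)) y₁ := by
    intro y₁
    by_cases hy : y₁ ∈ Set.Icc (-R) R
    · rw [indicator_of_mem hy]
      -- the set `{y₂ | |c₂ y₂ − e| < w}` is an open interval of length `2w/|c₂|`
      have hint : {y₂ : ℝ | |c₂ * y₂ - (-d - c₁ * y₁)| < w} =
          Set.Ioo (((-d - c₁ * y₁) - w) / c₂ ⊓ ((-d - c₁ * y₁) + w) / c₂)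
            (((-d - c₁ * y₁) - w) / c₂ ⊔ ((-d - c₁ * y₁) + w) / c₂) := by
        ext y₂
        simp only [mem_setOf_eq, mem_Ioo, abs_lt, inf_lt_iff, lt_sup_iff]
        rcases lt_or_gt_of_ne hc₂ with hneg | hpos
        · constructor
          · rintro ⟨h1, h2⟩
            refine ⟨Or.inr ((div_lt_iff_of_neg hneg).2 (by linarith)), Or.inl ((lt_div_iff_of_neg hneg).2 (by linarith))⟩
          · rintro ⟨h1, h2⟩
            rcases h1 with h1 | h1 <;> rcases h2 with h2 | h2
            · have := (div_lt_iff_of_neg hneg).1 h1; have := (lt_div_iff_of_neg hneg).1 h2; constructor <;> nlinarith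
            · have := (div_lt_iff_of_neg hneg).1 h1; have := (lt_div_iff_of_neg hneg).1 h2; constructor <;> nlinarith
            · have := (div_lt_iff_of_neg hneg).1 h1; have := (lt_div_iff_of_neg hneg).1 h2; constructor <;> nlinarith
            · have := (div_lt_iff_of_neg hneg).1 h1; have := (lt_div_iff_of_neg hneg).1 h2; constructor <;> nlinarith
        · constructor
          · rintro ⟨h1, h2⟩
            refine ⟨Or.inl ((div_lt_iff₀ hpos).2 (by linarith)), Or.inr ((lt_div_iff₀ hpos).2 (by linarith))⟩
          · rintro ⟨h1, h2⟩
            rcases h1 with h1 | h1 <;> rcases h2 with h2 | h2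
            · have := (div_lt_iff₀ hpos).1 h1; have := (lt_div_iff₀ hpos).1 h2; constructor <;> nlinarith
            · have := (div_lt_iff₀ hpos).1 h1; have := (lt_div_iff₀ hpos).1 h2; constructor <;> nlinarith
            · have := (div_lt_iff₀ hpos).1 h1; have := (lt_div_iff₀ hpos).1 h2; constructor <;> nlinarith
            · have := (div_lt_iff₀ hpos).1 h1; have := (lt_div_iff₀ hpos).1 h2; constructor <;> nlinarith
      have hle : volume (Prod.mk y₁ ⁻¹' S) ≤ volume {y₂ : ℝ | |c₂ * y₂ - (-d - c₁ * y₁)| < w} := by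
        refine measure_mono fun y₂ hy₂ => ?_
        have h := hy₂.1
        simp only [mem_setOf_eq] at h ⊢
        have : c₂ * y₂ - (-d - c₁ * y₁) = c₁ * y₁ + c₂ * y₂ + d := by ring
        rw [this]; exact h
      refine hle.trans ?_
      rw [hint, Real.volume_Ioo]
      refine ENNReal.ofReal_le_ofReal ?_
      have key : (((-d - c₁ * y₁) - w) / c₂ ⊔ ((-d - c₁ * y₁) + w) / c₂) -
          (((-d - c₁ * y₁) - w) / c₂ ⊓ ((-d - c₁ * y₁) + w) / c₂) =
          |((-d - c₁ * y₁) + w) / c₂ - ((-d - c₁ * y₁) - w) / c₂| := by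
        rw [max_sub_min_eq_abs', abs_sub_comm]
      rw [key, ← sub_div, abs_div, show (-d - c₁ * y₁ + w) - (-d - c₁ * y₁ - w) = 2 * w by ring,
        abs_of_nonneg (by linarith : (0:ℝ) ≤ 2 * w)]
    · rw [indicator_of_notMem hy]
      have : Prod.mk y₁ ⁻¹' S = ∅ := by
        ext y₂
        simp only [mem_preimage, hS, mem_inter_iff, mem_setOf_eq, mem_empty_iff_false, iff_false, not_and]
        exact fun _ h => hy h
      rw [this, measure_empty]
  calc ∫⁻ y₁, volume (Prod.mk y₁ ⁻¹' S) ≤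
      ∫⁻ y₁, (Set.Icc (-R) R).indicator (fun _ => ENNReal.ofReal (2 * w / |c₂|)) y₁ := lintegral_mono hsec
    _ = ENNReal.ofReal (2 * w / |c₂|) * volume (Set.Icc (-R) R) := by
        rw [lintegral_indicator measurableSet_Icc, setLIntegral_const]
    _ = ENNReal.ofReal (2 * R * (2 * w / |c₂|)) := by
        rw [Real.volume_Icc, show R - -R = 2 * R by ring, ← ENNReal.ofReal_mul (by positivity), mul_comm]

/-- **Two transversal thin slabs meet a ball in volume `O(w·w')`.**  For unit vectors `a, a'` with
`a' ≠ ±a` and a radius `R₀` there is `C ≥ 0` such that for all centres `α, α'` and half-widths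
`w, w' ≥ 0`:
`|{α−w < ⟪a,x⟫ < α+w} ∩ {α'−w' < ⟪a',x⟫ < α'+w'} ∩ B̄(0, R₀)| ≤ C·w·w'`. -/
theorem exists_volume_two_slabs_le {a a' : EuclideanSpace ℝ (Fin 3)} (ha : ‖a‖ = 1) (ha' : ‖a'‖ = 1)
    (hne : a' ≠ a) (hne' : a' ≠ -a) (R₀ : ℝ) :
    ∃ C : ℝ, 0 ≤ C ∧ ∀ α α' w w' : ℝ, 0 ≤ w → 0 ≤ w' →
      volume ({x : EuclideanSpace ℝ (Fin 3) | α - w < ⟪a, x⟫_ℝ ∧ ⟪a, x⟫_ℝ < α + w} ∩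
        {x | α' - w' < ⟪a', x⟫_ℝ ∧ ⟪a', x⟫_ℝ < α' + w'} ∩ Metric.closedBall 0 R₀) ≤
        ENNReal.ofReal (C * w * w') := by
  -- a frame `(U, V, a)` with `⟪a', V⟫ ≠ 0`
  obtain ⟨U₀, V₀, hU₀, hV₀, hUV₀, haU₀, haV₀⟩ :=
    Literature.Analysis.Convexity.exists_orthonormal_pair_perp a
  have hframe : ∃ U V : EuclideanSpace ℝ (Fin 3), ‖U‖ = 1 ∧ ‖V‖ = 1 ∧ ⟪U, V⟫_ℝ = 0 ∧ ⟪a, U⟫_ℝ = 0 ∧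
      ⟪a, V⟫_ℝ = 0 ∧ ⟪a', V⟫_ℝ ≠ 0 := by
    by_cases hV : ⟪a', V₀⟫_ℝ ≠ 0
    · exact ⟨U₀, V₀, hU₀, hV₀, hUV₀, haU₀, haV₀, hV⟩
    · push Not at hV
      by_cases hU : ⟪a', U₀⟫_ℝ ≠ 0
      · exact ⟨V₀, U₀, hV₀, hU₀, by rw [real_inner_comm]; exact hUV₀, haV₀, haU₀, hU⟩
      · -- `a' ⊥ U₀, V₀` forces `a' = ±a`
        push Not at hU
        exfalso
        have hon := Literature.Analysis.Convexity.orthonormal_vec_three ha hU₀ hV₀ hUV₀ haU₀ haV₀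
        have hsp : ⊤ ≤ Submodule.span ℝ (Set.range ![U₀, V₀, a]) :=
          (hon.linearIndependent.span_eq_top_of_card_eq_finrank (by simp)).ge
        set b : OrthonormalBasis (Fin 3) ℝ (EuclideanSpace ℝ (Fin 3)) := OrthonormalBasis.mk hon hsp
          with hb
        have hexp : ⟪U₀, a'⟫_ℝ • U₀ + ⟪V₀, a'⟫_ℝ • V₀ + ⟪a, a'⟫_ℝ • a = a' := by
          have h := b.sum_repr' a'
          simp only [Fin.sum_univ_three, hb] at h
          simpa using h
        rw [real_inner_comm, hU, real_inner_comm, hV, zero_smul, zero_smul, zero_add, zero_add] at hexp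
        set μ : ℝ := ⟪a, a'⟫_ℝ with hμ
        have hμ2 : μ ^ 2 = 1 := by
          have : ‖a'‖ ^ 2 = μ ^ 2 := by
            rw [← hexp, norm_smul, mul_pow, ha, Real.norm_eq_abs, sq_abs]; ring
          rw [ha', one_pow] at this; exact this.symm
        have hμ1 : μ = 1 ∨ μ = -1 := by
          have : (μ - 1) * (μ + 1) = 0 := by nlinarith [hμ2]
          rcases mul_eq_zero.1 this with h | h
          · left; linarith
          · right; linarith
        rcases hμ1 with h1 | h1
        · rw [h1, one_smul] at hexp; exact hne hexp.symm
        · rw [h1, neg_one_smul] at hexp; exact hne' hexp.symm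
  obtain ⟨U, V, hU, hV, hUV, haU, haV, hc₂⟩ := hframe
  set c₁ : ℝ := ⟪a', U⟫_ℝ with hc₁
  set c₂ : ℝ := ⟪a', V⟫_ℝ
  have haa : ⟪a, a⟫_ℝ = 1 := by rw [real_inner_self_eq_norm_sq, ha, one_pow]
  have hUU : ⟪U, U⟫_ℝ = 1 := by rw [real_inner_self_eq_norm_sq, hU, one_pow]
  have hVU : ⟪V, U⟫_ℝ = 0 := by rw [real_inner_comm]; exact hUV
  have hUa : ⟪U, a⟫_ℝ = 0 := by rw [real_inner_comm]; exact haU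
  refine ⟨8 * |R₀| / |c₂| + 1, by positivity, fun α α' w w' hw hw' => ?_⟩
  set S : Set (EuclideanSpace ℝ (Fin 3)) := {x | α' - w' < ⟪a', x⟫_ℝ ∧ ⟪a', x⟫_ℝ < α' + w'} ∩
    Metric.closedBall 0 R₀ with hS
  have hSm : MeasurableSet S := by
    have hslab : IsOpen {x : EuclideanSpace ℝ (Fin 3) | α' - w' < ⟪a', x⟫_ℝ ∧ ⟪a', x⟫_ℝ < α' + w'} :=
      (continuous_const.inner continuous_id).isOpen_preimage _ isOpen_Ioo
    exact hslab.measurableSet.inter Metric.isClosed_closedBall.measurableSet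
  have hset : {x : EuclideanSpace ℝ (Fin 3) | α - w < ⟪a, x⟫_ℝ ∧ ⟪a, x⟫_ℝ < α + w} ∩
      {x | α' - w' < ⟪a', x⟫_ℝ ∧ ⟪a', x⟫_ℝ < α' + w'} ∩ Metric.closedBall 0 R₀ =
      S ∩ {x | α - w < ⟪a, x⟫_ℝ ∧ ⟪a, x⟫_ℝ < α + w} := by
    ext x; simp only [hS, mem_inter_iff, mem_setOf_eq]; tauto
  rw [hset, volume_inter_slab_eq_lintegral ha hU hV hUV haU haV hSm]
  -- each section lies in a strip of the square
  have hsec : ∀ t, {y : ℝ × ℝ | y.1 • U + y.2 • V + t • a ∈ S} ⊆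
      {y : ℝ × ℝ | |c₁ * y.1 + c₂ * y.2 + (t * ⟪a', a⟫_ℝ - α')| < w'} ∩ {y | y.1 ∈ Set.Icc (-|R₀|) |R₀|} := by
    intro t y hy
    obtain ⟨⟨h1, h2⟩, hball⟩ := hy
    have hin : ⟪a', y.1 • U + y.2 • V + t • a⟫_ℝ = c₁ * y.1 + c₂ * y.2 + t * ⟪a', a⟫_ℝ := by
      simp only [inner_add_right, real_inner_smul_right, hc₁]; ring
    rw [hin] at h1 h2
    refine ⟨?_, ?_⟩
    · rw [mem_setOf_eq, abs_lt]; constructor <;> linarith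
    · have hnorm : ‖y.1 • U + y.2 • V + t • a‖ ≤ |R₀| :=
        le_trans (mem_closedBall_zero_iff.1 hball) (le_abs_self _)
      have hy1 : ⟪U, y.1 • U + y.2 • V + t • a⟫_ℝ = y.1 := by
        simp only [inner_add_right, real_inner_smul_right, hUU, hUV, hUa]; ring
      have h : |y.1| ≤ |R₀| := by
        rw [← hy1]
        exact le_trans (abs_real_inner_le_norm _ _) (by rw [hU, one_mul]; exact hnorm)
      exact abs_le.1 h
  calc ∫⁻ t in Set.Ioo (α - w) (α + w), volume {y : ℝ × ℝ | y.1 • U + y.2 • V + t • a ∈ S}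
      ≤ ∫⁻ _ in Set.Ioo (α - w) (α + w), ENNReal.ofReal (2 * |R₀| * (2 * w' / |c₂|)) :=
        setLIntegral_mono measurable_const fun t _ =>
          (measure_mono (hsec t)).trans (volume_strip_inter_le hc₂ hw')
    _ = ENNReal.ofReal (2 * |R₀| * (2 * w' / |c₂|)) * ENNReal.ofReal (2 * w) := by
        rw [setLIntegral_const, Real.volume_Ioo, show α + w - (α - w) = 2 * w by ring]
    _ ≤ ENNReal.ofReal ((8 * |R₀| / |c₂| + 1) * w * w') := by
        rw [← ENNReal.ofReal_mul (by positivity)]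
        refine ENNReal.ofReal_le_ofReal ?_
        have h1 : 2 * |R₀| * (2 * w' / |c₂|) * (2 * w) = (8 * |R₀| / |c₂|) * w * w' := by ring
        rw [h1]
        nlinarith [mul_nonneg hw hw']

end Summit.Ventures.Crystal3D.Theorems

end
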